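import Summits.MatrixMultiplication.MatrixMultiplication.Theorems.SoloInformedValLocalDegree

/-!
# SoloInformedValLabelled — labelled trapezoid configurations: the component lemma

K. Pratt, *On generalized corners and matrix multiplication*, arXiv:2309.03878, Def. 3.2 (`TrapezoidFreeG`,
`solutionsG` of `SoloInformedValConjecture`; `degC`, `card_solutionsG_eq_sum_degC` of `SoloInformedValLocalDegree`).

A triple `(A, B, C)` with target `t` in an additive commutative group `G` is LABELLED (`Labelled`) by maps
`lA : G → I × J`, `lB : G → J × K`, `lC : G → K × I` if these are injective on `A`, `B`, `C` and every solution
`a + b + c = t` matches labels cyclically: `(lA a).2 = (lB b).1`, `(lB b).2 = (lC c).1`, `(lC c).2 = (lA a).1`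
— a partial matrix-multiplication support `a(i,j) + b(j,k) + c(k,i) = t` realised additively without accidental
solutions (every STPP / local-USP transfer behind the superlinear values of `Val` is of this form).  We prove:

* `Labelled.trapezoidFreeG`: a labelled triple is equilateral trapezoid-free [Pratt, Def. 3.2];
* `Labelled.snd_eq_of_eqvGen`: the `J`-label is constant on the connected components of the solution graph
  `Γ_AB` (vertex classes `A ⊔ B`, an edge `{a, b}` for every solution `(a, b, t-a-b)`).  Two `A`-vertices lie in
  one component of this bipartite graph iff they are joined by a chain of common-`B`-neighbour steps, so on `A`
  the components are the classes of the equivalence closure of `CommonNbr` ("`a, a'` have a common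
  `B`-neighbour"); `compCount A B C t` = the number of such classes met by edge-carrying `A`-vertices = the number
  `c_AB` of connected components of `Γ_AB` that contain an edge;
* the COMPONENT LEMMA `Labelled.injOn_quotMk` / `Labelled.degC_le_compCount`: the `deg c` solutions through a
  fixed `c ∈ C` have their `A`-endpoints in pairwise distinct components of `Γ_AB`, so `deg c ≤ c_AB`; summing,
  `Labelled.card_solutionsG_le_compCount`: `#solutions ≤ #C · c_AB`, and with the cyclic images
  (`Labelled.cyclic`, `card_solutionsG_cyclic`) `Labelled.card_solutionsG_pow_three_le`:
  `#solutions ^ 3 ≤ (#A · #B · #C) · (c_AB · c_BC · c_CA)`; in particular a labelled triple one of whose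
  solution graphs is connected (`c_AB ≤ 1`) is linear (`#solutions ≤ #C`);
* LABEL FACTORISATION `Labelled.card_usedLabels_le_compCount`: the `J`-labels in use number at most `c_AB`
  (labels factor through components: the component labelling is the finest one), together with the label forms
  `Labelled.degC_le_card_usedLabels`, `Labelled.card_solutionsG_le_usedLabels` and, for finite label types,
  `Labelled.card_solutionsG_pow_three_le_card`: `#solutions ^ 3 ≤ (#A · #B · #C) · (|I| · |J| · |K|)`.

The component counts `c_AB, c_BC, c_CA` do not depend on the labelling, whereas the label counts do (label
names may be shared between components); so `#solutions ^ 3 ≤ #A #B #C · c_AB c_BC c_CA` is the invariant — and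
weakest — form of the bound.  solo-informed MatrixMultiplication, gen 74 (dossier `val-superlinear.md` §15.2,
§15.4(a)).
-/

namespace Summit.MatrixMultiplication.MatrixMultiplication.Theorems.SoloVal

open Finset

section Labelled

variable {G : Type*} [AddCommGroup G] [DecidableEq G]
variable {I J K : Type*}

/-- (S″) A LABELLING of the triple `(A, B, C; t)`: `lA : G → I × J`, `lB : G → J × K`, `lC : G → K × I`
injective on `A`, `B`, `C` respectively, such that every solution `a + b + c = t`, `a ∈ A, b ∈ B, c ∈ C`, has
matching labels `j(a) = j(b)`, `k(b) = k(c)`, `i(c) = i(a)`. -/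
def Labelled (A B C : Finset G) (t : G) (lA : G → I × J) (lB : G → J × K) (lC : G → K × I) : Prop :=
  Set.InjOn lA ↑A ∧ Set.InjOn lB ↑B ∧ Set.InjOn lC ↑C ∧
  ∀ a ∈ A, ∀ b ∈ B, ∀ c ∈ C, a + b + c = t →
    (lA a).2 = (lB b).1 ∧ (lB b).2 = (lC c).1 ∧ (lC c).2 = (lA a).1

omit [DecidableEq G] in
/-- The notion is invariant under the cyclic shift `(A, B, C) ↦ (B, C, A)` of parts and labellings. -/
theorem Labelled.cyclic {A B C : Finset G} {t : G} {lA : G → I × J} {lB : G → J × K} {lC : G → K × I}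
    (h : Labelled A B C t lA lB lC) : Labelled B C A t lB lC lA := by
  obtain ⟨hA, hB, hC, hm⟩ := h
  refine ⟨hB, hC, hA, ?_⟩
  intro b hb c hc a ha hsum
  have hsum' : a + b + c = t := by rw [← hsum]; abel
  obtain ⟨h1, h2, h3⟩ := hm a ha b hb c hc hsum'
  exact ⟨h2, h3, h1⟩

omit [DecidableEq G] in
/-- A labelled triple is equilateral trapezoid-free [Pratt, Def. 3.2]: in each of the three systems the two
candidate solutions carry equal labels on the coordinate to be identified, which is then equal by injectivity. -/
theorem Labelled.trapezoidFreeG {A B C : Finset G} {t : G} {lA : G → I × J} {lB : G → J × K}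
    {lC : G → K × I} (h : Labelled A B C t lA lB lC) : TrapezoidFreeG A B C t := by
  obtain ⟨hA, hB, hC, hm⟩ := h
  refine ⟨?_, ?_, ?_⟩
  · intro a' ha' b' hb' c₁ hc₁ c₂ hc₂ h1 h2 h3 h4
    have s1 := hm a' ha' (t - a' - c₁) h1 c₁ hc₁ (by abel)
    have s2 := hm (t - b' - c₁) h2 b' hb' c₁ hc₁ (by abel)
    have s3 := hm a' ha' (t - a' - c₂) h3 c₂ hc₂ (by abel)
    have s4 := hm (t - b' - c₂) h4 b' hb' c₂ hc₂ (by abel)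
    exact hC hc₁ hc₂ (Prod.ext (s2.2.1.symm.trans s4.2.1) (s1.2.2.trans s3.2.2.symm))
  · intro a' ha' c' hc' b₁ hb₁ b₂ hb₂ h1 h2 h3 h4
    have s1 := hm a' ha' b₁ hb₁ (t - a' - b₁) h1 (by abel)
    have s2 := hm (t - c' - b₁) h2 b₁ hb₁ c' hc' (by abel)
    have s3 := hm a' ha' b₂ hb₂ (t - a' - b₂) h3 (by abel)
    have s4 := hm (t - c' - b₂) h4 b₂ hb₂ c' hc' (by abel)
    exact hB hb₁ hb₂ (Prod.ext (s1.1.symm.trans s3.1) (s2.2.1.trans s4.2.1.symm))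
  · intro b' hb' c' hc' a₁ ha₁ a₂ ha₂ h1 h2 h3 h4
    have s1 := hm a₁ ha₁ b' hb' (t - b' - a₁) h1 (by abel)
    have s2 := hm a₁ ha₁ (t - c' - a₁) h2 c' hc' (by abel)
    have s3 := hm a₂ ha₂ b' hb' (t - b' - a₂) h3 (by abel)
    have s4 := hm a₂ ha₂ (t - c' - a₂) h4 c' hc' (by abel)
    exact hA ha₁ ha₂ (Prod.ext (s2.2.2.symm.trans s4.2.2) (s1.1.trans s3.1.symm))

/-- The solution count is invariant under the cyclic shift of the parts. -/
theorem card_solutionsG_cyclic (A B C : Finset G) (t : G) :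
    (solutionsG B C A t).card = (solutionsG A B C t).card := by
  refine card_nbij' (fun q => (q.2.2, q.1, q.2.1)) (fun p => (p.2.1, p.2.2, p.1)) ?_ ?_ ?_ ?_
  · intro q hq
    obtain ⟨hq1, hq2⟩ := mem_filter.1 (mem_coe.1 hq)
    simp only [mem_product] at hq1
    refine mem_coe.2 (mem_filter.2 ⟨?_, ?_⟩)
    · simp only [mem_product]; exact ⟨hq1.2.2, hq1.1, hq1.2.1⟩
    · rw [← hq2]; abel
  · intro p hp
    obtain ⟨hp1, hp2⟩ := mem_filter.1 (mem_coe.1 hp)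
    simp only [mem_product] at hp1
    refine mem_coe.2 (mem_filter.2 ⟨?_, ?_⟩)
    · simp only [mem_product]; exact ⟨hp1.2.1, hp1.2.2, hp1.1⟩
    · rw [← hp2]; abel
  · intro q _
    rfl
  · intro p _
    rfl

/-! ### The solution graph `Γ_AB` seen from `A`: common neighbours, carriers, components -/

/-- `a, a' ∈ A` have a COMMON NEIGHBOUR in the solution graph `Γ_AB`: some `b ∈ B` with both `(a, b, t-a-b)` and
`(a', b, t-a'-b)` solutions.  Its equivalence closure is "same connected component of `Γ_AB`" on `A`-vertices
carrying an edge. -/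
def CommonNbr (A B C : Finset G) (t : G) (a a' : G) : Prop :=
  a ∈ A ∧ a' ∈ A ∧ ∃ b ∈ B, t - a - b ∈ C ∧ t - a' - b ∈ C

/-- The `A`-vertices of `Γ_AB` that carry an edge, i.e. lie on at least one solution. -/
def carriers (A B C : Finset G) (t : G) : Finset G := A.filter (fun a => ∃ b ∈ B, t - a - b ∈ C)

/-- Membership in `carriers`. -/
theorem mem_carriers {A B C : Finset G} {t a : G} :
    a ∈ carriers A B C t ↔ a ∈ A ∧ ∃ b ∈ B, t - a - b ∈ C := by
  simp only [carriers, mem_filter]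

open Classical in
/-- `c_AB`: the number of connected components of the solution graph `Γ_AB` containing an edge, counted as the
number of classes of edge-carrying `A`-vertices modulo the equivalence closure of `CommonNbr`. -/
noncomputable def compCount (A B C : Finset G) (t : G) : ℕ :=
  ((carriers A B C t).image (Quot.mk (CommonNbr A B C t))).card

/-- Trivially `c_AB ≤ #(edge-carrying A-vertices) ≤ #A`. -/
theorem compCount_le_card (A B C : Finset G) (t : G) : compCount A B C t ≤ A.card := by
  classical
  unfold compCount
  exact card_image_le.trans (card_filter_le _ _)

/-- An `A`-vertex on a solution through `c` carries an edge of `Γ_AB`. -/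
theorem mem_carriers_of_mem {A B C : Finset G} {t a c : G} (ha : a ∈ A) (hc : c ∈ C) (hb : t - a - c ∈ B) :
    a ∈ carriers A B C t := by
  refine mem_carriers.2 ⟨ha, t - a - c, hb, ?_⟩
  have : t - a - (t - a - c) = c := by abel
  rw [this]; exact hc

variable {A B C : Finset G} {t : G} {lA : G → I × J} {lB : G → J × K} {lC : G → K × I}

omit [DecidableEq G] in
/-- In a labelled triple the `J`-label is constant on the connected components of `Γ_AB` (on `A`-vertices):
along an edge `{a, b}` one has `j(a) = j(b)`. -/
theorem Labelled.snd_eq_of_eqvGen (h : Labelled A B C t lA lB lC) {a a' : G}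
    (e : Relation.EqvGen (CommonNbr A B C t) a a') : (lA a).2 = (lA a').2 := by
  induction e with
  | rel x y hxy =>
      obtain ⟨hx, hy, b, hb, hxb, hyb⟩ := hxy
      have s1 := h.2.2.2 x hx b hb (t - x - b) hxb (by abel)
      have s2 := h.2.2.2 y hy b hb (t - y - b) hyb (by abel)
      exact s1.1.trans s2.1.symm
  | refl x => rfl
  | symm x y _ ih => exact ih.symm
  | trans x y z _ _ ih1 ih2 => exact ih1.trans ih2

omit [DecidableEq G] in
/-- In a labelled triple all solutions through a fixed `c ∈ C` have `A`-endpoints with the `I`-label of `c`. -/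
theorem Labelled.fst_eq_of_mem (h : Labelled A B C t lA lB lC) {a c : G} (ha : a ∈ A) (hc : c ∈ C)
    (hb : t - a - c ∈ B) : (lA a).1 = (lC c).2 :=
  ((h.2.2.2 a ha (t - a - c) hb c hc (by abel)).2.2).symm

/-- COMPONENT LEMMA.  In a labelled triple the solutions through a fixed `c ∈ C` have their `A`-endpoints in
pairwise distinct connected components of `Γ_AB`: two such endpoints in one component would share the
`J`-label (constant on components) and the `I`-label (that of `c`), hence coincide by injectivity of `lA`. -/
theorem Labelled.injOn_quotMk (h : Labelled A B C t lA lB lC) {c : G} (hc : c ∈ C) :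
    Set.InjOn (Quot.mk (CommonNbr A B C t)) ↑(A.filter (fun a => t - a - c ∈ B)) := by
  intro a₁ ha₁ a₂ ha₂ he
  have h1 := mem_filter.1 (mem_coe.1 ha₁)
  have h2 := mem_filter.1 (mem_coe.1 ha₂)
  have ej : (lA a₁).2 = (lA a₂).2 := h.snd_eq_of_eqvGen (Quot.eqvGen_exact he)
  have ei : (lA a₁).1 = (lA a₂).1 :=
    (h.fst_eq_of_mem h1.1 hc h1.2).trans (h.fst_eq_of_mem h2.1 hc h2.2).symm
  exact h.1 h1.1 h2.1 (Prod.ext ei ej)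

/-- Hence `deg c ≤ c_AB` for every `c ∈ C` of a labelled triple. -/
theorem Labelled.degC_le_compCount (h : Labelled A B C t lA lB lC) {c : G} (hc : c ∈ C) :
    degC A B t c ≤ compCount A B C t := by
  classical
  unfold degC compCount
  refine card_le_card_of_injOn (Quot.mk (CommonNbr A B C t)) ?_ (h.injOn_quotMk hc)
  intro a ha
  have ha' := mem_filter.1 (mem_coe.1 ha)
  exact mem_coe.2 (mem_image.2 ⟨a, mem_carriers_of_mem ha'.1 hc ha'.2, rfl⟩)

/-- `#solutions ≤ #C · c_AB` for a labelled triple (and cyclically `≤ #A · c_BC`, `≤ #B · c_CA`, by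
`Labelled.cyclic` and `card_solutionsG_cyclic`). -/
theorem Labelled.card_solutionsG_le_compCount (h : Labelled A B C t lA lB lC) :
    (solutionsG A B C t).card ≤ C.card * compCount A B C t := by
  rw [card_solutionsG_eq_sum_degC]
  calc ∑ c ∈ C, degC A B t c ≤ ∑ c ∈ C, compCount A B C t :=
        sum_le_sum (fun c hc => h.degC_le_compCount hc)
    _ = C.card * compCount A B C t := by rw [sum_const, smul_eq_mul]

/-- A labelled triple whose solution graph `Γ_AB` has at most one component with an edge (e.g. `Γ_AB`
connected) is LINEAR: `#solutions ≤ #C`. -/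
theorem Labelled.card_solutionsG_le_card_of_compCount_le_one (h : Labelled A B C t lA lB lC)
    (h1 : compCount A B C t ≤ 1) : (solutionsG A B C t).card ≤ C.card := by
  calc (solutionsG A B C t).card ≤ C.card * compCount A B C t := h.card_solutionsG_le_compCount
    _ ≤ C.card * 1 := Nat.mul_le_mul_left _ h1
    _ = C.card := mul_one _

/-- THE INVARIANT CUBE BOUND: `#solutions ^ 3 ≤ (#A · #B · #C) · (c_AB · c_BC · c_CA)` for a labelled triple,
where `c_BC = compCount B C A t` (components of `Γ_BC` on `B`-vertices) and `c_CA = compCount C A B t`. -/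
theorem Labelled.card_solutionsG_pow_three_le (h : Labelled A B C t lA lB lC) :
    (solutionsG A B C t).card ^ 3 ≤
      (A.card * B.card * C.card) * (compCount A B C t * compCount B C A t * compCount C A B t) := by
  have h1 := h.card_solutionsG_le_compCount
  have h2 := h.cyclic.card_solutionsG_le_compCount
  have h3 := h.cyclic.cyclic.card_solutionsG_le_compCount
  rw [card_solutionsG_cyclic] at h2
  rw [card_solutionsG_cyclic, card_solutionsG_cyclic] at h3
  calc (solutionsG A B C t).card ^ 3
      = (solutionsG A B C t).card * (solutionsG A B C t).card * (solutionsG A B C t).card := by ring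
    _ ≤ (C.card * compCount A B C t) * (A.card * compCount B C A t) * (B.card * compCount C A B t) :=
        Nat.mul_le_mul (Nat.mul_le_mul h1 h2) h3
    _ = (A.card * B.card * C.card) * (compCount A B C t * compCount B C A t * compCount C A B t) := by ring

/-! ### Label forms and the factorisation of labels through components -/

/-- The `J`-labels in use on the edge-carrying `A`-vertices (for a labelling `lA : G → I × J`). -/
def usedLabels [DecidableEq J] (A B C : Finset G) (t : G) (lA : G → I × J) : Finset J :=
  (carriers A B C t).image (fun a => (lA a).2)

/-- The number of labels in use is at most the number of labels. -/
theorem card_usedLabels_le_card [DecidableEq J] [Fintype J] (A B C : Finset G) (t : G) (lA : G → I × J) :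
    (usedLabels A B C t lA).card ≤ Fintype.card J :=
  card_le_univ _

/-- LABEL FACTORISATION: the `J`-labels of a labelled triple factor through the components of `Γ_AB`, so at most
`c_AB` of them are in use — the component labelling is the finest labelling, and coarser labellings only merge
label names across components. -/
theorem Labelled.card_usedLabels_le_compCount [DecidableEq J] (h : Labelled A B C t lA lB lC) :
    (usedLabels A B C t lA).card ≤ compCount A B C t := by
  classical
  unfold usedLabels compCount
  refine card_le_card_of_surjOn
    (Quot.lift (fun a => (lA a).2) (fun x y hxy => h.snd_eq_of_eqvGen (Relation.EqvGen.rel x y hxy))) ?_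
  intro j hj
  obtain ⟨a, ha, rfl⟩ := mem_image.1 (mem_coe.1 hj)
  exact ⟨Quot.mk _ a, mem_coe.2 (mem_image.2 ⟨a, ha, rfl⟩), rfl⟩

/-- Label form of the component lemma: `deg c ≤ #(J-labels in use)` — the solutions through `c` have pairwise
distinct `J`-labels at their `A`-endpoints (their `I`-labels all equal that of `c`). -/
theorem Labelled.degC_le_card_usedLabels [DecidableEq J] (h : Labelled A B C t lA lB lC) {c : G}
    (hc : c ∈ C) : degC A B t c ≤ (usedLabels A B C t lA).card := by
  unfold degC usedLabels
  refine card_le_card_of_injOn (fun a => (lA a).2) ?_ ?_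
  · intro a ha
    have ha' := mem_filter.1 (mem_coe.1 ha)
    exact mem_coe.2 (mem_image.2 ⟨a, mem_carriers_of_mem ha'.1 hc ha'.2, rfl⟩)
  · intro a₁ ha₁ a₂ ha₂ he
    have h1 := mem_filter.1 (mem_coe.1 ha₁)
    have h2 := mem_filter.1 (mem_coe.1 ha₂)
    have ei : (lA a₁).1 = (lA a₂).1 :=
      (h.fst_eq_of_mem h1.1 hc h1.2).trans (h.fst_eq_of_mem h2.1 hc h2.2).symm
    exact h.1 h1.1 h2.1 (Prod.ext ei he)

/-- `#solutions ≤ #C · #(J-labels in use)` for a labelled triple. -/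
theorem Labelled.card_solutionsG_le_usedLabels [DecidableEq J] (h : Labelled A B C t lA lB lC) :
    (solutionsG A B C t).card ≤ C.card * (usedLabels A B C t lA).card := by
  rw [card_solutionsG_eq_sum_degC]
  calc ∑ c ∈ C, degC A B t c ≤ ∑ c ∈ C, (usedLabels A B C t lA).card :=
        sum_le_sum (fun c hc => h.degC_le_card_usedLabels hc)
    _ = C.card * (usedLabels A B C t lA).card := by rw [sum_const, smul_eq_mul]

/-- The label cube bound for finite label types: `#solutions ^ 3 ≤ (#A · #B · #C) · (|I| · |J| · |K|)`. -/
theorem Labelled.card_solutionsG_pow_three_le_card [Fintype I] [Fintype J] [Fintype K] [DecidableEq I]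
    [DecidableEq J] [DecidableEq K] (h : Labelled A B C t lA lB lC) :
    (solutionsG A B C t).card ^ 3 ≤
      (A.card * B.card * C.card) * (Fintype.card I * Fintype.card J * Fintype.card K) := by
  have h1 := (h.card_solutionsG_le_usedLabels).trans
    (Nat.mul_le_mul_left _ (card_usedLabels_le_card A B C t lA))
  have h2 := (h.cyclic.card_solutionsG_le_usedLabels).trans
    (Nat.mul_le_mul_left _ (card_usedLabels_le_card B C A t lB))
  have h3 := (h.cyclic.cyclic.card_solutionsG_le_usedLabels).trans
    (Nat.mul_le_mul_left _ (card_usedLabels_le_card C A B t lC))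
  rw [card_solutionsG_cyclic] at h2
  rw [card_solutionsG_cyclic, card_solutionsG_cyclic] at h3
  calc (solutionsG A B C t).card ^ 3
      = (solutionsG A B C t).card * (solutionsG A B C t).card * (solutionsG A B C t).card := by ring
    _ ≤ (C.card * Fintype.card J) * (A.card * Fintype.card K) * (B.card * Fintype.card I) :=
        Nat.mul_le_mul (Nat.mul_le_mul h1 h2) h3
    _ = (A.card * B.card * C.card) * (Fintype.card I * Fintype.card J * Fintype.card K) := by ring

end Labelled

end Summit.MatrixMultiplication.MatrixMultiplication.Theorems.SoloVal
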